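import Literature.MathematicalPhysics.KineticTheory.LangevinChainGeneratorStep
import Literature.MathematicalPhysics.KineticTheory.PhaseSpacePoisson
import Mathlib.Analysis.Calculus.BumpFunction.FiniteDimension

/-!
# `PhononMeanFreePath.IncoherentBounded` — the carré du champ of the Langevin generator along the constructed kernels

Helper file for item `stmt-AtomisticToContinuum-11815` (support `IncoherentBounded`, route `PhononMeanFreePath`,
sub-problem `FouriersLaw`). The item asks for an `N`-UNIFORM bound on a time-integrated equilibrium correlation of
the pinned anharmonic chain; the only `N`-uniform handle on the constructed transition kernels `K_t` of
`LangevinChainKernel.lean` is the energy (variance) dissipation of the equilibrium semigroup, whose rate is the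
**carré du champ** `Γ(f) = ½ (L(f²) - 2 f L f) = γ (T_L (∂_{p_0} f)² + T_R (∂_{p_{N-1}} f)²)` of the generator `L` of
`FouriersLaw.lean` (Bakry–Émery). This file proves, for the kernels of the pinned chain (`ω₂ > 0`, `lam, β, γ ≥ 0`,
`N ≥ 1`, `T_L, T_R ≥ 0`):

* `generator_sq_sub_two_mul` — the algebraic identity `L(f²) - 2 f L f = 2 γ ∑_i w_i (∂_{p_i} f)²`,
  `w_i = [i = 0] T_L + [i = N-1] T_R`, for `f ∈ C²` (the drift is a derivation; only the bath Laplacians survive);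
* `kernel_variance_step` — the **one-step variance expansion**, uniform in the starting point:
  `|K_h(f²)(y) - (K_h f(y))² - 2h Γ(f)(y)| ≤ ε h` for `h ≤ h₀(ε)` and all `y`, for `f ∈ C²_c`
  (from the uniform one-step generator estimate `pinnedChain_generator_step` applied to `f` and `f²`);
* `kernel_variance_step_of_bounded` — **localisation**: the same expansion AT A POINT `x` for a bounded `u ∈ C²`
  without compact support (cut `u` off by a bump `χ ≡ 1` near `x`; the defect is controlled by `1 - K_h χ(x) = o(h)`,
  again `pinnedChain_generator_step`, since `Lχ(x) = 0`).

No definitions (the carré du champ is written out). These feed the dissipation inequality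
`∫₀^∞ ∫ 2Γ(K_s F) dμ_T ds ≤ ∫ F² dμ_T` (file `…IncoherentBoundedDissipation`).
-/

noncomputable section

open MeasureTheory ProbabilityTheory Filter Topology Set
open scoped NNReal ENNReal ContDiff
open Literature.MathematicalPhysics.KineticTheory.HeatConduction
open Literature.MathematicalPhysics.KineticTheory Literature.Probability.Process OscillatorChain

namespace Summit.AtomisticToContinuum.FouriersLaw.Theorems.IncoherentBounded

variable {N : ℕ}

/-! ## 1. The carré du champ identity `L(f²) - 2 f Lf = 2γ ∑ w_i (∂_{p_i} f)²` -/

/-- **Carré du champ of the Langevin generator.** For `f ∈ C²` and any oscillator chain,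
`L(f²)(x) - 2 f(x) Lf(x) = 2 γ ∑_i ([i=0] T_L + [i=N-1] T_R) (∂_{p_i} f(x))²`: the transport part
`Y·∇` of `L` is a derivation and drops out, the bath Laplacians leave the squared momentum gradients at the
bath sites (Bakry–Émery `Γ(f) = γ T_L (∂_{p_0}f)² + γ T_R (∂_{p_{N-1}}f)²`). [folklore] -/
theorem generator_sq_sub_two_mul (P : OscillatorChain) (N : ℕ) (T_L T_R : ℝ) {f : PhaseSpace N → ℝ}
    (hf : ContDiff ℝ 2 f) (x : PhaseSpace N) :
    P.generator N T_L T_R (fun z => f z ^ 2) x - 2 * f x * P.generator N T_L T_R f x =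
      2 * (P.γ * ∑ i : Fin N, ((if i.val = 0 then T_L else 0) + (if i.val = N - 1 then T_R else 0)) *
        partialP i f x ^ 2) := by
  have hfd : Differentiable ℝ f := hf.differentiable (by norm_num)
  have hf1 : ∀ i, Differentiable ℝ (partialP i f) := fun i =>
    (contDiff_partialP hf (m := 1) (by norm_num) i).differentiable one_ne_zero
  have hsq : (fun z => f z ^ 2) = f * f := by funext z; simp [sq]
  have hfd2 : Differentiable ℝ (fun z => f z ^ 2) := by rw [hsq]; exact hfd.mul hfd
  rw [P.generator_eq_fderiv_drift_add N T_L T_R hfd2 x, P.generator_eq_fderiv_drift_add N T_L T_R hfd x]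
  have h1 : fderiv ℝ (fun z => f z ^ 2) x (P.drift N x) = 2 * f x * fderiv ℝ f x (P.drift N x) := by
    rw [hsq, fderiv_mul (hfd x) (hfd x)]
    simp only [add_apply, smul_apply, smul_eq_mul]
    ring
  have h2 : ∀ i, partialP i (partialP i (fun z => f z ^ 2)) x =
      2 * partialP i f x ^ 2 + 2 * f x * partialP i (partialP i f) x := by
    intro i
    have e1 : partialP i (fun z => f z ^ 2) = fun z => 2 * (f * partialP i f) z := by
      funext z
      rw [hsq, partialP_mul hfd hfd]
      simp only [Pi.mul_apply]
      ring
    rw [e1, partialP_const_mul, partialP_mul hfd (hf1 i)]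
    ring
  rw [h1]
  simp only [h2]
  have h3 : ∀ i : Fin N, ((if i.val = 0 then T_L else 0) + (if i.val = N - 1 then T_R else 0)) *
      (2 * partialP i f x ^ 2 + 2 * f x * partialP i (partialP i f) x) =
      2 * (((if i.val = 0 then T_L else 0) + (if i.val = N - 1 then T_R else 0)) * partialP i f x ^ 2) +
        2 * f x * (((if i.val = 0 then T_L else 0) + (if i.val = N - 1 then T_R else 0)) *
          partialP i (partialP i f) x) := fun i => by ring
  simp only [h3, Finset.sum_add_distrib, ← Finset.mul_sum]
  ring

/-! ## 2. The one-step variance expansion along the kernels of the pinned chain -/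

section Step

variable {ω₂ lam β γ : ℝ} (hω : 0 < ω₂) (hl : 0 ≤ lam) (hβ : 0 ≤ β) (hγ : 0 ≤ γ)
  (hN : 0 < N) {T_L T_R : ℝ} (hTL : 0 ≤ T_L) (hTR : 0 ≤ T_R)
include hω hl hβ hγ hN hTL hTR

/-- Kernel form of the uniform one-step generator estimate `pinnedChain_generator_step`:
`|K_h f(y) - f(y) - h Lf(y)| ≤ ε h` for `0 < h ≤ h₀(ε)` and all `y`, `f ∈ C²_c`.
[cite: CuneoEckmannHairerReyBellet2018, §3 p. 7] -/
theorem kernel_generator_step {f : PhaseSpace N → ℝ} (hf : ContDiff ℝ 2 f) (hfc : HasCompactSupport f)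
    {ε : ℝ} (hε : 0 < ε) :
    ∃ h₀ : ℝ, 0 < h₀ ∧ ∀ h : ℝ≥0, 0 < (h : ℝ) → (h : ℝ) ≤ h₀ → ∀ y : PhaseSpace N,
      |(∫ z, f z ∂((pinnedChain ω₂ lam β γ).transitionKernel N T_L T_R h y)) - f y -
          h * (pinnedChain ω₂ lam β γ).generator N T_L T_R f y| ≤ ε * h := by
  obtain ⟨h₀, hh₀, H⟩ := pinnedChain_generator_step hω hl hβ hγ hN hTL hTR hf hfc hε
  refine ⟨h₀, hh₀, fun h hh hh' y => ?_⟩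
  rw [pinnedChain_integral_transitionKernel hω hl hβ hγ N T_L T_R h y hf.continuous.aestronglyMeasurable]
  exact H h hh hh' y

/-- **One-step variance expansion, uniform in the starting point.** For `f ∈ C²_c` and `ε > 0` there is
`h₀ > 0` with `|K_h(f²)(y) - (K_h f(y))² - h · 2Γ(f)(y)| ≤ ε h` for all `0 < h ≤ h₀` and all `y`, where
`2Γ(f) = L(f²) - 2fLf = 2γ ∑_i w_i (∂_{p_i}f)²`: the conditional variance of `f` after a short time `h` is
`2hΓ(f) + o(h)`. [folklore] -/
theorem kernel_variance_step {f : PhaseSpace N → ℝ} (hf : ContDiff ℝ 2 f) (hfc : HasCompactSupport f)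
    {ε : ℝ} (hε : 0 < ε) :
    ∃ h₀ : ℝ, 0 < h₀ ∧ ∀ h : ℝ≥0, 0 < (h : ℝ) → (h : ℝ) ≤ h₀ → ∀ y : PhaseSpace N,
      |(∫ z, f z ^ 2 ∂((pinnedChain ω₂ lam β γ).transitionKernel N T_L T_R h y)) -
          (∫ z, f z ∂((pinnedChain ω₂ lam β γ).transitionKernel N T_L T_R h y)) ^ 2 -
          h * (2 * (γ * ∑ i : Fin N, ((if i.val = 0 then T_L else 0) + (if i.val = N - 1 then T_R else 0)) *
            partialP i f y ^ 2))| ≤ ε * h := by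
  set P := pinnedChain ω₂ lam β γ with hP
  have hPγ : P.γ = γ := rfl
  -- bounds on f and Lf
  obtain ⟨M, hM⟩ : ∃ M, ∀ x, ‖f x‖ ≤ M := hf.continuous.bounded_above_of_compact_support hfc
  have hM0 : 0 ≤ M := (norm_nonneg _).trans (hM 0)
  obtain ⟨CL, hCL⟩ := P.exists_bound_generator (pinnedChain_contDiff_U ω₂ lam β γ)
    (pinnedChain_contDiff_V ω₂ lam β γ) N T_L T_R hf hfc
  have hCL0 : 0 ≤ CL := (norm_nonneg _).trans (hCL 0)
  -- f² ∈ C²_c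
  have hf2 : ContDiff ℝ 2 (fun z => f z ^ 2) := hf.pow 2
  have hf2c : HasCompactSupport (fun z => f z ^ 2) := by
    have : (fun z => f z ^ 2) = f * f := by funext z; simp [sq]
    rw [this]; exact hfc.mul_left
  -- the two one-step estimates with accuracy ε'
  set ε' : ℝ := ε / (2 * (1 + 2 * M)) with hε'
  have hε'0 : 0 < ε' := by positivity
  obtain ⟨h₁, hh₁, H1⟩ := kernel_generator_step hω hl hβ hγ hN hTL hTR hf2 hf2c hε'0
  obtain ⟨h₂, hh₂, H2⟩ := kernel_generator_step hω hl hβ hγ hN hTL hTR hf hfc hε'0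
  set h₃ : ℝ := ε / (2 * (CL + ε') ^ 2 + 1) with hh₃def
  have hh₃ : 0 < h₃ := by positivity
  refine ⟨min (min h₁ h₂) h₃, lt_min (lt_min hh₁ hh₂) hh₃, fun h hh hh' y => ?_⟩
  have hhh₁ : (h : ℝ) ≤ h₁ := hh'.trans ((min_le_left _ _).trans (min_le_left _ _))
  have hhh₂ : (h : ℝ) ≤ h₂ := hh'.trans ((min_le_left _ _).trans (min_le_right _ _))
  have hhh₃ : (h : ℝ) ≤ h₃ := hh'.trans (min_le_right _ _)
  have e1 := H1 h hh hhh₁ y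
  have e2 := H2 h hh hhh₂ y
  -- abbreviations
  set A := ∫ z, f z ^ 2 ∂(P.transitionKernel N T_L T_R h y) with hA
  set B := ∫ z, f z ∂(P.transitionKernel N T_L T_R h y) with hB
  set L2 := P.generator N T_L T_R (fun z => f z ^ 2) y with hL2
  set L1 := P.generator N T_L T_R f y with hL1
  set G := 2 * (γ * ∑ i : Fin N, ((if i.val = 0 then T_L else 0) + (if i.val = N - 1 then T_R else 0)) *
            partialP i f y ^ 2) with hG
  have hGid : L2 - 2 * f y * L1 = G := by
    rw [hL2, hL1, hG, ← hPγ]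
    exact generator_sq_sub_two_mul P N T_L T_R hf y
  -- algebra: A - B² - hG = e₁ - 2 f e₂ - (h L1 + e₂)²
  set d1 := A - f y ^ 2 - h * L2 with hd1
  set d2 := B - f y - h * L1 with hd2
  have hkey : A - B ^ 2 - h * G = d1 - 2 * f y * d2 - (h * L1 + d2) ^ 2 := by
    rw [← hGid, hd1, hd2]; ring
  rw [hkey]
  have hfy : |f y| ≤ M := by simpa [Real.norm_eq_abs] using hM y
  have hL1b : |L1| ≤ CL := by simpa [Real.norm_eq_abs] using hCL y
  have hh0 : 0 ≤ (h : ℝ) := h.2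
  -- |d1| ≤ ε' h, |d2| ≤ ε' h
  have hd1b : |d1| ≤ ε' * h := e1
  have hd2b : |d2| ≤ ε' * h := e2
  have t1 : |2 * f y * d2| ≤ 2 * M * (ε' * h) := by
    rw [abs_mul, abs_mul, abs_two]
    exact mul_le_mul (mul_le_mul_of_nonneg_left hfy zero_le_two) hd2b (abs_nonneg _) (by positivity)
  have t2 : |(h * L1 + d2) ^ 2| ≤ (h * (CL + ε')) ^ 2 := by
    rw [abs_pow, sq_abs]
    have hb : |h * L1 + d2| ≤ h * (CL + ε') := by
      calc |h * L1 + d2| ≤ |h * L1| + |d2| := abs_add_le _ _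
        _ ≤ h * CL + ε' * h := add_le_add (by rw [abs_mul, abs_of_nonneg hh0]; gcongr) hd2b
        _ = h * (CL + ε') := by ring
    calc (h * L1 + d2) ^ 2 = |h * L1 + d2| ^ 2 := (sq_abs _).symm
      _ ≤ (h * (CL + ε')) ^ 2 := pow_le_pow_left₀ (abs_nonneg _) hb 2
  have hsum : |d1 - 2 * f y * d2 - (h * L1 + d2) ^ 2| ≤
      ε' * h + 2 * M * (ε' * h) + (h * (CL + ε')) ^ 2 := by
    calc |d1 - 2 * f y * d2 - (h * L1 + d2) ^ 2|
        ≤ |d1 - 2 * f y * d2| + |(h * L1 + d2) ^ 2| := abs_sub _ _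
      _ ≤ (|d1| + |2 * f y * d2|) + |(h * L1 + d2) ^ 2| := add_le_add_left (abs_sub _ _) _
      _ ≤ (ε' * h + 2 * M * (ε' * h)) + (h * (CL + ε')) ^ 2 := by gcongr
  -- first part: ε'(1+2M) h = ε h / 2
  have p1 : ε' * h + 2 * M * (ε' * h) = ε / 2 * h := by
    rw [hε']; field_simp
  -- second part: h² (CL+ε')² ≤ ε h / 2 since h ≤ h₃
  have p2 : (h * (CL + ε')) ^ 2 ≤ ε / 2 * h := by
    have hc : (h : ℝ) * (CL + ε') ^ 2 ≤ ε / 2 := by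
      have h3' : (h : ℝ) * (2 * (CL + ε') ^ 2 + 1) ≤ ε := by
        have := mul_le_mul_of_nonneg_right hhh₃ (by positivity : (0 : ℝ) ≤ 2 * (CL + ε') ^ 2 + 1)
        rwa [hh₃def, div_mul_cancel₀ _ (by positivity : (2 * (CL + ε') ^ 2 + 1 : ℝ) ≠ 0)] at this
      nlinarith [sq_nonneg (CL + ε')]
    calc (h * (CL + ε')) ^ 2 = h * (h * (CL + ε') ^ 2) := by ring
      _ ≤ h * (ε / 2) := mul_le_mul_of_nonneg_left hc hh0
      _ = ε / 2 * h := by ring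
  calc |d1 - 2 * f y * d2 - (h * L1 + d2) ^ 2|
      ≤ ε' * h + 2 * M * (ε' * h) + (h * (CL + ε')) ^ 2 := hsum
    _ ≤ ε / 2 * h + ε / 2 * h := by rw [p1]; gcongr
    _ = ε * h := by ring

/-! ## 3. Localisation: the expansion at a point for bounded `C²` functions -/

omit hω hl hβ hγ hN hTL hTR in
/-- A function that is eventually constant near `x` has all its coordinate momentum derivatives, first and
second, vanishing at `x`. [folklore] -/
theorem partialP_partialP_eq_zero_of_eventuallyEq_const {g : PhaseSpace N → ℝ} (hg : ContDiff ℝ 2 g)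
    {x : PhaseSpace N} {c : ℝ} (hx : g =ᶠ[𝓝 x] fun _ => c) (i : Fin N) :
    partialP i g x = 0 ∧ partialP i (partialP i g) x = 0 := by
  have hgd : Differentiable ℝ g := hg.differentiable (by norm_num)
  have hg1 : Differentiable ℝ (partialP i g) :=
    (contDiff_partialP hg (m := 1) (by norm_num) i).differentiable one_ne_zero
  -- near x, ∂_{p_i} g vanishes
  have hloc : partialP i g =ᶠ[𝓝 x] fun _ => (0 : ℝ) := by
    have h' : ∀ᶠ z in 𝓝 x, g =ᶠ[𝓝 z] fun _ => c := hx.eventually_nhds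
    filter_upwards [h'] with z hz
    simp only [partialP_eq_fderiv hgd, hz.fderiv_eq]
    simp
  refine ⟨?_, ?_⟩
  · exact hloc.self_of_nhds
  · simp only [partialP_eq_fderiv hg1, hloc.fderiv_eq]
    simp

omit hω hl hβ hγ hN hTL hTR in
/-- The generator kills, at `x`, any `C²` function constant near `x` (locality of `L`). [folklore] -/
theorem generator_eq_zero_of_eventuallyEq_const (P : OscillatorChain) (T_L T_R : ℝ) {g : PhaseSpace N → ℝ}
    (hg : ContDiff ℝ 2 g) {x : PhaseSpace N} {c : ℝ} (hx : g =ᶠ[𝓝 x] fun _ => c) :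
    P.generator N T_L T_R g x = 0 := by
  have hgd : Differentiable ℝ g := hg.differentiable (by norm_num)
  have h0 : fderiv ℝ g x = 0 := by rw [hx.fderiv_eq]; simp
  rw [P.generator_eq_fderiv_drift_add N T_L T_R hgd x, h0, zero_apply, zero_add,
    Finset.sum_eq_zero (fun i _ => by rw [(partialP_partialP_eq_zero_of_eventuallyEq_const hg hx i).2, mul_zero]),
    mul_zero]

/-- **One-step variance expansion at a point for bounded `C²` functions.** Let `u ∈ C²` with `|u| ≤ M`
(no compact support). Then for every `x` and `ε > 0` there is `h₀ > 0` with
`|K_h(u²)(x) - (K_h u(x))² - h · 2Γ(u)(x)| ≤ ε h` for `0 < h ≤ h₀`. Proof: cut `u` off with a bump `χ`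
(`χ ≡ 1` on the unit ball at `x`), apply `kernel_variance_step` to `χu ∈ C²_c`, and control the two defects by
`|u² - (χu)²| ≤ 2M²(1-χ)`, `|u - χu| ≤ M(1-χ)` and `∫ (1-χ) dK_h(x,·) = 1 - K_hχ(x) ≤ ε' h` (`Lχ(x) = 0`). [folklore] -/
theorem kernel_variance_step_of_bounded {u : PhaseSpace N → ℝ} (hu : ContDiff ℝ 2 u) {M : ℝ}
    (hM : ∀ z, |u z| ≤ M) (x : PhaseSpace N) {ε : ℝ} (hε : 0 < ε) :
    ∃ h₀ : ℝ, 0 < h₀ ∧ ∀ h : ℝ≥0, 0 < (h : ℝ) → (h : ℝ) ≤ h₀ →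
      |(∫ z, u z ^ 2 ∂((pinnedChain ω₂ lam β γ).transitionKernel N T_L T_R h x)) -
          (∫ z, u z ∂((pinnedChain ω₂ lam β γ).transitionKernel N T_L T_R h x)) ^ 2 -
          h * (2 * (γ * ∑ i : Fin N, ((if i.val = 0 then T_L else 0) + (if i.val = N - 1 then T_R else 0)) *
            partialP i u x ^ 2))| ≤ ε * h := by
  set P := pinnedChain ω₂ lam β γ with hP
  haveI : ∀ h, IsMarkovKernel (P.transitionKernel N T_L T_R h) := fun h =>
    pinnedChain_isMarkovKernel_transitionKernel hω hl hβ hγ N T_L T_R h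
  have hM0 : 0 ≤ M := (abs_nonneg _).trans (hM x)
  have huc : Continuous u := hu.continuous
  have hud : Differentiable ℝ u := hu.differentiable (by norm_num)
  -- the bump
  let χ : ContDiffBump x := ⟨1, 2, one_pos, one_lt_two⟩
  have hχs : ContDiff ℝ 2 (χ : PhaseSpace N → ℝ) := χ.contDiff
  have hχc : HasCompactSupport (χ : PhaseSpace N → ℝ) := χ.hasCompactSupport
  have hχ1 : (χ : PhaseSpace N → ℝ) =ᶠ[𝓝 x] fun _ => (1 : ℝ) := by
    filter_upwards [Metric.closedBall_mem_nhds x one_pos] with z hz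
    exact χ.one_of_mem_closedBall hz
  have hχ01 : ∀ z, 0 ≤ (χ : PhaseSpace N → ℝ) z ∧ (χ : PhaseSpace N → ℝ) z ≤ 1 :=
    fun z => ⟨χ.nonneg, χ.le_one⟩
  -- the cut-off function f = χ u ∈ C²_c, equal to u near x
  set f : PhaseSpace N → ℝ := fun z => (χ : PhaseSpace N → ℝ) z * u z with hf
  have hfs : ContDiff ℝ 2 f := hχs.mul hu
  have hfc : HasCompactSupport f := hχc.mul_right
  have hfx : f =ᶠ[𝓝 x] u := by
    filter_upwards [hχ1] with z hz
    simp [hf, hz]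
  have hfd : Differentiable ℝ f := hfs.differentiable (by norm_num)
  have hpf : ∀ i, partialP i f x = partialP i u x := fun i => by
    simp only [partialP_eq_fderiv hfd, partialP_eq_fderiv hud, hfx.fderiv_eq]
  have hfb : ∀ z, |f z| ≤ M := fun z => by
    rw [hf, abs_mul, abs_of_nonneg (hχ01 z).1]
    exact (mul_le_of_le_one_left (abs_nonneg _) (hχ01 z).2).trans (hM z)
  -- accuracy
  set ε' : ℝ := ε / (1 + 4 * M ^ 2) with hε'
  have hε'0 : 0 < ε' := by positivity
  obtain ⟨h₁, hh₁, H1⟩ := kernel_variance_step hω hl hβ hγ hN hTL hTR hfs hfc hε'0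
  obtain ⟨h₂, hh₂, H2⟩ := kernel_generator_step hω hl hβ hγ hN hTL hTR hχs hχc hε'0
  refine ⟨min h₁ h₂, lt_min hh₁ hh₂, fun h hh hh' => ?_⟩
  have e1 := H1 h hh (hh'.trans (min_le_left _ _)) x
  have e2 := H2 h hh (hh'.trans (min_le_right _ _)) x
  simp only [hpf] at e1
  set κ := P.transitionKernel N T_L T_R h x with hκ
  -- `Lχ(x) = 0`, `χ(x) = 1`: `0 ≤ 1 - K_h χ(x) ≤ ε' h`
  have hLχ : P.generator N T_L T_R (χ : PhaseSpace N → ℝ) x = 0 :=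
    generator_eq_zero_of_eventuallyEq_const P T_L T_R hχs hχ1
  have hχx : (χ : PhaseSpace N → ℝ) x = 1 := χ.one_of_mem_closedBall (Metric.mem_closedBall_self one_pos.le)
  rw [hLχ, mul_zero, sub_zero, hχx] at e2
  -- integrability of the bounded continuous integrands against the probability measure κ
  have hint : ∀ {g : PhaseSpace N → ℝ}, Continuous g → ∀ C, (∀ z, |g z| ≤ C) → Integrable g κ :=
    fun hg C hC => (integrable_const C).mono' hg.aestronglyMeasurable
      (Eventually.of_forall fun z => by rw [Real.norm_eq_abs]; exact hC z)
  have hiχ : Integrable (χ : PhaseSpace N → ℝ) κ := hint χ.continuous 1 fun z => by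
    rw [abs_of_nonneg (hχ01 z).1]; exact (hχ01 z).2
  have hiu : Integrable u κ := hint huc M hM
  have hif : Integrable f κ := hint hfs.continuous M hfb
  have hiu2 : Integrable (fun z => u z ^ 2) κ := hint (huc.pow 2) (M ^ 2) fun z => by
    rw [abs_pow]; exact pow_le_pow_left₀ (abs_nonneg _) (hM z) 2
  have hif2 : Integrable (fun z => f z ^ 2) κ := hint (hfs.continuous.pow 2) (M ^ 2) fun z => by
    rw [abs_pow]; exact pow_le_pow_left₀ (abs_nonneg _) (hfb z) 2
  -- the defect `D = ∫ (1 - χ) dκ = 1 - K_h χ (x)`, `0 ≤ D ≤ ε' h`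
  set D := ∫ z, (1 - (χ : PhaseSpace N → ℝ) z) ∂κ with hD
  have hDeq : D = 1 - ∫ z, (χ : PhaseSpace N → ℝ) z ∂κ := by
    rw [hD, integral_sub (integrable_const 1) hiχ, integral_const, probReal_univ, smul_eq_mul, one_mul]
  have hDle : D ≤ ε' * h := by
    rw [hDeq]
    have e2' : |∫ z, (χ : PhaseSpace N → ℝ) z ∂κ - 1| ≤ ε' * h := e2
    calc 1 - ∫ z, (χ : PhaseSpace N → ℝ) z ∂κ ≤ |1 - ∫ z, (χ : PhaseSpace N → ℝ) z ∂κ| := le_abs_self _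
      _ = |∫ z, (χ : PhaseSpace N → ℝ) z ∂κ - 1| := abs_sub_comm _ _
      _ ≤ ε' * h := e2'
  -- defect 1: |K(u²) - K(f²)| ≤ 2M² D
  have hd1 : |(∫ z, u z ^ 2 ∂κ) - ∫ z, f z ^ 2 ∂κ| ≤ 2 * M ^ 2 * D := by
    rw [← integral_sub hiu2 hif2, hD, ← integral_const_mul]
    refine (abs_integral_le_integral_abs).trans (integral_mono_of_nonneg (Eventually.of_forall fun z => abs_nonneg _)
      ((integrable_const _).sub hiχ |>.const_mul _) (Eventually.of_forall fun z => ?_))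
    have hc := hχ01 z
    show |u z ^ 2 - f z ^ 2| ≤ 2 * M ^ 2 * (1 - (χ : PhaseSpace N → ℝ) z)
    have : u z ^ 2 - f z ^ 2 = u z ^ 2 * ((1 - (χ : PhaseSpace N → ℝ) z) * (1 + (χ : PhaseSpace N → ℝ) z)) := by
      rw [hf]; ring
    rw [this, abs_mul, abs_mul, abs_of_nonneg (by linarith : 0 ≤ 1 - (χ : PhaseSpace N → ℝ) z),
      abs_of_nonneg (by linarith : 0 ≤ 1 + (χ : PhaseSpace N → ℝ) z)]
    have hu2 : |u z ^ 2| ≤ M ^ 2 := by rw [abs_pow]; exact pow_le_pow_left₀ (abs_nonneg _) (hM z) 2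
    calc |u z ^ 2| * ((1 - (χ : PhaseSpace N → ℝ) z) * (1 + (χ : PhaseSpace N → ℝ) z))
        ≤ M ^ 2 * ((1 - (χ : PhaseSpace N → ℝ) z) * 2) := by
          apply mul_le_mul hu2 _ (by nlinarith) (by positivity)
          nlinarith
      _ = 2 * M ^ 2 * (1 - (χ : PhaseSpace N → ℝ) z) := by ring
  -- defect 2: |Ku - Kf| ≤ M D
  have hd2 : |(∫ z, u z ∂κ) - ∫ z, f z ∂κ| ≤ M * D := by
    rw [← integral_sub hiu hif, hD, ← integral_const_mul]
    refine (abs_integral_le_integral_abs).trans (integral_mono_of_nonneg (Eventually.of_forall fun z => abs_nonneg _)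
      ((integrable_const _).sub hiχ |>.const_mul _) (Eventually.of_forall fun z => ?_))
    have hc := hχ01 z
    show |u z - f z| ≤ M * (1 - (χ : PhaseSpace N → ℝ) z)
    have : u z - f z = u z * (1 - (χ : PhaseSpace N → ℝ) z) := by rw [hf]; ring
    rw [this, abs_mul, abs_of_nonneg (by linarith : 0 ≤ 1 - (χ : PhaseSpace N → ℝ) z)]
    exact mul_le_mul_of_nonneg_right (hM z) (by linarith)
  -- |Ku|, |Kf| ≤ M
  have hKb : ∀ {g : PhaseSpace N → ℝ}, Integrable g κ → (∀ z, |g z| ≤ M) → |∫ z, g z ∂κ| ≤ M :=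
    fun hg hb => by
      calc |∫ z, _ ∂κ| ≤ ∫ z, |_| ∂κ := abs_integral_le_integral_abs
        _ ≤ ∫ z, M ∂κ := integral_mono hg.abs (integrable_const M) hb
        _ = M := by rw [integral_const, probReal_univ, smul_eq_mul, one_mul]
  have hKu : |∫ z, u z ∂κ| ≤ M := hKb hiu hM
  have hKf : |∫ z, f z ∂κ| ≤ M := hKb hif hfb
  have hd3 : |(∫ z, u z ∂κ) ^ 2 - (∫ z, f z ∂κ) ^ 2| ≤ 2 * M ^ 2 * D := by
    have : (∫ z, u z ∂κ) ^ 2 - (∫ z, f z ∂κ) ^ 2 =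
        ((∫ z, u z ∂κ) - ∫ z, f z ∂κ) * ((∫ z, u z ∂κ) + ∫ z, f z ∂κ) := by ring
    rw [this, abs_mul]
    have hs : |(∫ z, u z ∂κ) + ∫ z, f z ∂κ| ≤ 2 * M :=
      (abs_add_le _ _).trans (by linarith)
    have hD0 : 0 ≤ D := by
      rw [hD]; exact integral_nonneg fun z => by have := (hχ01 z).2; simp only [Pi.zero_apply]; linarith
    calc |(∫ z, u z ∂κ) - ∫ z, f z ∂κ| * |(∫ z, u z ∂κ) + ∫ z, f z ∂κ| ≤ (M * D) * (2 * M) :=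
          mul_le_mul hd2 hs (abs_nonneg _) (by positivity)
      _ = 2 * M ^ 2 * D := by ring
  -- assemble
  set G := (h : ℝ) * (2 * (γ * ∑ i : Fin N, ((if i.val = 0 then T_L else 0) + (if i.val = N - 1 then T_R else 0)) *
            partialP i u x ^ 2)) with hG
  have hsplit : (∫ z, u z ^ 2 ∂κ) - (∫ z, u z ∂κ) ^ 2 - G =
      ((∫ z, f z ^ 2 ∂κ) - (∫ z, f z ∂κ) ^ 2 - G) +
        (((∫ z, u z ^ 2 ∂κ) - ∫ z, f z ^ 2 ∂κ) - ((∫ z, u z ∂κ) ^ 2 - (∫ z, f z ∂κ) ^ 2)) := by ring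
  rw [hsplit]
  have hh0 : 0 ≤ (h : ℝ) := h.2
  calc |((∫ z, f z ^ 2 ∂κ) - (∫ z, f z ∂κ) ^ 2 - G) +
        (((∫ z, u z ^ 2 ∂κ) - ∫ z, f z ^ 2 ∂κ) - ((∫ z, u z ∂κ) ^ 2 - (∫ z, f z ∂κ) ^ 2))|
      ≤ |(∫ z, f z ^ 2 ∂κ) - (∫ z, f z ∂κ) ^ 2 - G| +
          (|(∫ z, u z ^ 2 ∂κ) - ∫ z, f z ^ 2 ∂κ| + |(∫ z, u z ∂κ) ^ 2 - (∫ z, f z ∂κ) ^ 2|) :=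
        (abs_add_le _ _).trans (add_le_add_right (abs_sub _ _) _)
    _ ≤ ε' * h + (2 * M ^ 2 * D + 2 * M ^ 2 * D) := by gcongr
    _ ≤ ε' * h + 4 * M ^ 2 * (ε' * h) := by nlinarith [hDle, sq_nonneg M]
    _ = ε * h := by rw [hε']; field_simp

end Step

end Summit.AtomisticToContinuum.FouriersLaw.Theorems.IncoherentBounded

end
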